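import Summits.Ventures.LatticeQCDFlow.Exactness.SU2A0Marginal
import Summits.Ventures.LatticeQCDFlow.Scoring.OnePlaquetteBessel
import Summits.Ventures.LatticeQCDFlow.Scoring.OnePlaquetteSU2Characters
import Summits.Ventures.LatticeQCDFlow.Scaling.LatticePeeling
import Literature.MathematicalPhysics.QuantumLattice.GaugeGroups
import HarnessLib

/-!
# SU(2): Haar integrals of class functions of the trace ARE the class-angle integrals — the Weyl integration formula from the semicircle marginal; theory-2's SU(2) one-plaquette integral `z₁(β) = e^{−2β} I₁(2β)/β` and the Haar one-plaquette law in Bessel form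

HONEST FRAMING: exact (Metropolis-corrected) sampling algorithms for lattice gauge theory;
figures of merit are autocorrelation/cost numbers at stated couplings and volumes; no
continuum-physics claim.

Venture `LatticeQCDFlow` (cell pub-lqcd), sub-topic `Scoring`; FANOUT row 5 (`s0-sun-a`), GEN-9.
NEW WORK of the cell (placement rule), the FIRST of the lead's NOT-TYPED items "SU(N) torus / open
formulas" at `N = 2`: the bridge between

* the HAAR side — theory-2's Wilson theory `wilsonMeasure ρ β` / `partitionFunction ρ β` /
  one-plaquette integral `Theory2.Lattice.z1 ρ β = ∫ e^{−β(N − Re tr ρ g)} dHaar(g)`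
  (`Literature…ConstructiveQFTWave0`, `Scaling/LatticePeeling.lean`) for `G = SU(2)`,
  `ρ = fundamentalRep (Fin 2)` (`N = 2`, weight `e^{−β(2 − tr U)} = e^{−2β} e^{4β a₀}`,
  `a₀ = Re tr U / 2`), and
* the CLASS-ANGLE side — the objects the cell's oracle / reference table and row 5's kernel
  enclosures are about: `onePlaquetteZSU2 b = ∫₀^π sin²α e^{b cos α} dα`,
  `onePlaquetteExpectSU2 b f` (`Scoring/SchwingerDysonOnePlaquette.lean`), identified with Bessel
  functions in `Scoring/OnePlaquetteBessel.lean` / `OnePlaquetteSU2Characters.lean`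
  (`b·Z₂(b) = π I₁(b)`, `Z₂(b) = (π/2)(I₀(b) − I₂(b))`, `⟨cos α⟩_b = I₂(b)/I₁(b)`).

The dictionary is `b = 2β` (the standard lattice coupling of `S = b Σ (1 − ½ tr U_p)` versus
theory-2's `S = β Σ (2 − Re tr U_p)`).

## Content

* §1 **Weyl's integration formula for SU(2)** (class functions of the trace):
  `integral_comp_su2a0_eq` — `∫ g(a₀(U)) dHaar_SU(2)(U) = ∫_{−1}^{1} g(t)·(2/π)√(1 − t²) dt`
  (row 9's semicircle marginal `Exactness.map_su2a0_haarProbability`, pushed through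
  `integral_map`), `intervalIntegral_mul_semicircleDensity_eq` — the substitution `t = cos α`,
  `∫_{−1}^{1} g(t)(2/π)√(1 − t²) dt = (2/π)∫₀^π g(cos α) sin²α dα`, hence
  **`integral_comp_su2a0_eq_classAngle`** — `∫ g(a₀(U)) dHaar = (2/π)∫₀^π g(cos α) sin²α dα`
  (Bröcker–tom Dieck IV (1.11) for SU(2); Creutz, *Quarks, gluons and lattices* (8.20)).
* §2 **theory-2's one-plaquette integral of SU(2) in Bessel form**:
  `z1_su2_eq_classAngle` — `z₁(β) = e^{−2β}·(2/π)·Z₂(2β)`; `z1_su2_eq_besselI` —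
  `z₁(β) = e^{−2β}(I₀(2β) − I₂(2β))`; `z1_su2_eq_besselI_one` — `z₁(β) = e^{−2β} I₁(2β)/β`
  (`β ≠ 0`); `z1_su2_toReal_pos`.
* §3 **the Haar one-plaquette law is the class-angle law**: `haar_su2_expect_eq_onePlaquetteExpectSU2`
  — for continuous `f`, `∫ f(a₀) e^{−β(2−tr U)} dHaar / ∫ e^{−β(2−tr U)} dHaar = ⟨f ∘ cos⟩_{2β}`;
  `haar_su2_mean_su2a0_eq_besselI_div` — `⟨½ tr U⟩ = I₂(2β)/I₁(2β)`, the SU(2) plaquette of the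
  cell's reference table (GEN-5's kernel enclosures at `b = 1.8, 2.2, 2.7` are enclosures of THIS
  Haar expectation at `β = 0.9, 1.1, 1.35`).
* The 2-torus consequences (lean-1's sandwich in Bessel form, the punctured-torus plaquette law) are
  the companion file `Scoring/SU2TorusPartitionFunctionBessel.lean`.

NOT here (still NOT TYPED): the EXACT SU(2) torus formula
`Z = Σ_j (e^{−2β}·2I_{2j+1}(2β)/(2β))^{L²}·(2j+1)^{0}`-type character sum (needs Schur
orthogonality for every irreducible representation of SU(2) — Peter–Weyl); SU(3) (the Weyl
integration formula over the maximal torus of SU(3) is not in the tree); Wilson loops larger than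
one plaquette for non-abelian `G`.
-/

noncomputable section

open Real MeasureTheory intervalIntegral Set
open Literature.MathematicalPhysics.QuantumFieldTheory Literature.MathematicalPhysics.QuantumLattice
open Literature.Analysis.FunctionSpaces
open Summit.Ventures.LatticeQCDFlow.Exactness
open Summit.Ventures.LatticeQCDFlow.Theory2.Lattice

namespace Summit.Ventures.LatticeQCDFlow.Scoring

/-! ## §1. Weyl's integration formula for SU(2) (class functions of the trace) -/

/-- **Haar integrals of functions of `a₀ = Re tr U/2` are semicircle integrals**:
`∫ g(a₀(U)) dHaar_SU(2) = ∫_{−1}^{1} g(t)·(2/π)√(1 − t²) dt` (measurable `g`). -/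
theorem integral_comp_su2a0_eq (g : ℝ → ℝ) (hg : Measurable g) :
    ∫ U, g (su2a0 U) ∂(haarProbability (Matrix.specialUnitaryGroup (Fin 2) ℂ)) = ∫ t in (-1 : ℝ)..1, g t * semicircleDensity t := by
  rw [← integral_semicircleLaw, ← map_su2a0_haarProbability,
    integral_map continuous_su2a0.aemeasurable hg.aestronglyMeasurable]

/-- **The substitution `t = cos α`**: `∫_{−1}^{1} g(t)(2/π)√(1 − t²) dt = (2/π)∫₀^π g(cos α) sin²α dα`
(continuous `g`; on `[0, π]`, `sin α = √(1 − cos²α)`). -/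
theorem intervalIntegral_mul_semicircleDensity_eq (g : ℝ → ℝ) (hg : Continuous g) :
    ∫ t in (-1 : ℝ)..1, g t * semicircleDensity t =
      2 / π * ∫ α in (0 : ℝ)..π, g (Real.cos α) * Real.sin α ^ 2 := by
  have hG : Continuous fun t => g t * Real.sqrt (1 - t ^ 2) :=
    hg.mul ((continuous_const.sub (continuous_pow 2)).sqrt)
  have h1 : ∀ α ∈ uIcc (0 : ℝ) π, HasDerivAt Real.cos (-Real.sin α) α :=
    fun α _ => Real.hasDerivAt_cos α
  have h2 : ContinuousOn (fun α => -Real.sin α) (uIcc (0 : ℝ) π) :=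
    Real.continuous_sin.neg.continuousOn
  have h3 := intervalIntegral.integral_comp_mul_deriv' h1 h2 hG.continuousOn
  have h4 : ∫ x in (0 : ℝ)..π, ((fun t => g t * Real.sqrt (1 - t ^ 2)) ∘ Real.cos) x * -Real.sin x
      = -∫ x in (0 : ℝ)..π, g (Real.cos x) * Real.sin x ^ 2 := by
    rw [← intervalIntegral.integral_neg]
    refine intervalIntegral.integral_congr fun x hx => ?_
    rw [uIcc_of_le Real.pi_pos.le] at hx
    simp only [Function.comp_apply]
    rw [← Real.sin_eq_sqrt_one_sub_cos_sq hx.1 hx.2]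
    ring
  rw [h4, Real.cos_zero, Real.cos_pi, intervalIntegral.integral_symm (-1 : ℝ) 1] at h3
  have key : ∫ x in (0 : ℝ)..π, g (Real.cos x) * Real.sin x ^ 2 =
      ∫ t in (-1 : ℝ)..1, g t * Real.sqrt (1 - t ^ 2) := neg_injective h3
  have h5 : (fun t => g t * semicircleDensity t) = fun t => 2 / π * (g t * Real.sqrt (1 - t ^ 2)) := by
    funext t; simp only [semicircleDensity]; ring
  rw [h5, intervalIntegral.integral_const_mul, key]

/-- **Weyl's integration formula for SU(2)**: for continuous `g`,
`∫ g(Re tr U/2) dHaar_SU(2)(U) = (2/π)∫₀^π g(cos α) sin²α dα` — the reduced Haar weight of the class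
angle `α` (eigenvalues `e^{±iα}`) is `(2/π) sin²α dα`. -/
theorem integral_comp_su2a0_eq_classAngle (g : ℝ → ℝ) (hg : Continuous g) :
    ∫ U, g (su2a0 U) ∂(haarProbability (Matrix.specialUnitaryGroup (Fin 2) ℂ)) =
      2 / π * ∫ α in (0 : ℝ)..π, g (Real.cos α) * Real.sin α ^ 2 := by
  rw [integral_comp_su2a0_eq g hg.measurable, intervalIntegral_mul_semicircleDensity_eq g hg]

/-! ## §2. theory-2's one-plaquette integral `z₁` of SU(2) in class-angle and Bessel form -/

/-- `Re tr U = 2 a₀(U)` for the fundamental representation of SU(2). -/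
theorem fundamentalRep_trace_re (U : (Matrix.specialUnitaryGroup (Fin 2) ℂ)) :
    ((fundamentalRep (Fin 2) U).trace).re = 2 * su2a0 U := by
  rw [fundamentalRep_apply, su2a0]; ring

/-- The SU(2) Wilson one-plaquette weight of theory-2 as a function of `a₀`:
`e^{−β(2 − Re tr U)} = e^{−2β}·e^{(2β)·(2a₀(U))}`… written as `g(a₀)` with
`g(t) = e^{−(β(2 − 2t))}`. -/
theorem su2_plaqWeight_eq (β : ℝ) (U : (Matrix.specialUnitaryGroup (Fin 2) ℂ)) :
    Real.exp (-(β * (((2 : ℕ) : ℝ) - ((fundamentalRep (Fin 2) U).trace).re))) =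
      Real.exp (-(β * (2 - 2 * su2a0 U))) := by
  rw [fundamentalRep_trace_re]; norm_num

/-- `e^{−β(2 − 2cos α)} = e^{−2β}·e^{2β cos α}`. -/
theorem exp_neg_mul_two_sub (β c : ℝ) :
    Real.exp (-(β * (2 - 2 * c))) = Real.exp (-(2 * β)) * Real.exp (2 * β * c) := by
  rw [← Real.exp_add]
  congr 1
  ring

/-- `(2/π)·((π/2)·X) = X`. -/
theorem two_div_pi_mul (X : ℝ) : 2 / π * (π / 2 * X) = X := by
  have h : (π * 2 : ℝ) ≠ 0 := by positivity
  rw [← mul_assoc, div_mul_div_comm, mul_comm (2 : ℝ) π, div_self h, one_mul]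

/-- **theory-2's SU(2) one-plaquette integral in the class angle**:
`z₁(β) = ∫ e^{−β(2 − tr U)} dHaar_SU(2) = e^{−2β}·(2/π)·Z₂(2β)`,
`Z₂(b) = ∫₀^π sin²α e^{b cos α} dα`. -/
theorem z1_su2_eq_classAngle (β : ℝ) :
    z1 (fundamentalRep (Fin 2)) β =
      ENNReal.ofReal (Real.exp (-(2 * β)) * (2 / π * onePlaquetteZSU2 (2 * β))) := by
  unfold z1
  simp_rw [su2_plaqWeight_eq]
  have hc : Continuous fun U : (Matrix.specialUnitaryGroup (Fin 2) ℂ) => Real.exp (-(β * (2 - 2 * su2a0 U))) := by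
    have := continuous_su2a0; fun_prop
  rw [← ofReal_integral_eq_lintegral_ofReal (integrable_of_continuous_SU2 hc)
    (Filter.Eventually.of_forall fun U => (Real.exp_pos _).le)]
  congr 1
  rw [integral_comp_su2a0_eq_classAngle (fun t => Real.exp (-(β * (2 - 2 * t)))) (by fun_prop)]
  simp_rw [exp_neg_mul_two_sub]
  rw [onePlaquetteZSU2]
  have h : (fun α => Real.exp (-(2 * β)) * Real.exp (2 * β * Real.cos α) * Real.sin α ^ 2) =
      fun α => Real.exp (-(2 * β)) * (Real.sin α ^ 2 * Real.exp (2 * β * Real.cos α)) := by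
    funext α; ring
  rw [h, intervalIntegral.integral_const_mul]
  ring

/-- **`z₁(β) = e^{−2β}(I₀(2β) − I₂(2β))`** (theory-2's SU(2) one-plaquette integral; the character
coefficient `c₀ = I₀ − I₂` of `OnePlaquetteSU2Characters.lean` at `b = 2β`). -/
theorem z1_su2_eq_besselI (β : ℝ) :
    z1 (fundamentalRep (Fin 2)) β =
      ENNReal.ofReal (Real.exp (-(2 * β)) * (besselI 0 (2 * β) - besselI 2 (2 * β))) := by
  rw [z1_su2_eq_classAngle, onePlaquetteZSU2_eq, two_div_pi_mul]

/-- **`z₁(β) = e^{−2β}·I₁(2β)/β`** for `β ≠ 0` (`b·Z₂(b) = π I₁(b)` at `b = 2β`). -/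
theorem z1_su2_eq_besselI_one {β : ℝ} (hβ : β ≠ 0) :
    z1 (fundamentalRep (Fin 2)) β =
      ENNReal.ofReal (Real.exp (-(2 * β)) * besselI 1 (2 * β) / β) := by
  rw [z1_su2_eq_classAngle]
  congr 1
  have h := beta_mul_onePlaquetteZSU2 (2 * β)
  have h2β : (2 * β : ℝ) ≠ 0 := mul_ne_zero two_ne_zero hβ
  have h2 : onePlaquetteZSU2 (2 * β) = π * besselI 1 (2 * β) / (2 * β) := by
    rw [eq_div_iff h2β, mul_comm _ (2 * β), h]
  have h3 : 2 / π * (π * besselI 1 (2 * β) / (2 * β)) = besselI 1 (2 * β) / β := by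
    rw [div_mul_div_comm, div_eq_div_iff (mul_ne_zero Real.pi_ne_zero h2β) hβ]
    ring
  rw [h2, h3, mul_div_assoc]

/-- The real value: `z₁(β).toReal = e^{−2β}(I₀(2β) − I₂(2β)) = e^{−2β}·(2/π)·Z₂(2β) > 0`. -/
theorem z1_su2_toReal (β : ℝ) :
    (z1 (fundamentalRep (Fin 2)) β).toReal =
      Real.exp (-(2 * β)) * (besselI 0 (2 * β) - besselI 2 (2 * β)) := by
  have h := onePlaquetteZSU2_eq (2 * β)
  have hpos := onePlaquetteZSU2_pos (2 * β)
  have h0 : 0 < besselI 0 (2 * β) - besselI 2 (2 * β) := by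
    have h1 : besselI 0 (2 * β) - besselI 2 (2 * β) = 2 / π * onePlaquetteZSU2 (2 * β) := by
      rw [h, two_div_pi_mul]
    rw [h1]; positivity
  rw [z1_su2_eq_besselI, ENNReal.toReal_ofReal (mul_nonneg (Real.exp_pos _).le h0.le)]

/-- `z₁(β) > 0` as a real number (the integrand `sin²α e^{2β cos α}` is positive on `(0, π)`). -/
theorem z1_su2_toReal_pos (β : ℝ) : 0 < (z1 (fundamentalRep (Fin 2)) β).toReal := by
  have hZ := onePlaquetteZSU2_pos (2 * β)
  have h0 : 0 < Real.exp (-(2 * β)) * (2 / π * onePlaquetteZSU2 (2 * β)) := by positivity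
  rw [z1_su2_eq_classAngle, ENNReal.toReal_ofReal h0.le]
  exact h0

/-! ## §3. The Haar one-plaquette law of SU(2) is the class-angle law -/

/-- **Haar one-plaquette expectations of class observables are class-angle expectations**: for
continuous `f`,
`∫ f(a₀(U)) e^{−β(2 − tr U)} dHaar(U) / ∫ e^{−β(2 − tr U)} dHaar(U) = ⟨f ∘ cos⟩_{2β}`
(`onePlaquetteExpectSU2`, weight `sin²α e^{2β cos α}`). -/
theorem haar_su2_expect_eq_onePlaquetteExpectSU2 (β : ℝ) (f : ℝ → ℝ) (hf : Continuous f) :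
    (∫ U, f (su2a0 U) * Real.exp (-(β * (2 - 2 * su2a0 U))) ∂(haarProbability (Matrix.specialUnitaryGroup (Fin 2) ℂ))) /
        (∫ U, Real.exp (-(β * (2 - 2 * su2a0 U))) ∂(haarProbability (Matrix.specialUnitaryGroup (Fin 2) ℂ))) =
      onePlaquetteExpectSU2 (2 * β) (fun α => f (Real.cos α)) := by
  rw [integral_comp_su2a0_eq_classAngle (fun t => f t * Real.exp (-(β * (2 - 2 * t)))) (by fun_prop),
    integral_comp_su2a0_eq_classAngle (fun t => Real.exp (-(β * (2 - 2 * t)))) (by fun_prop),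
    onePlaquetteExpectSU2, onePlaquetteZSU2]
  simp_rw [exp_neg_mul_two_sub]
  have hn : (fun α => f (Real.cos α) * (Real.exp (-(2 * β)) * Real.exp (2 * β * Real.cos α)) *
      Real.sin α ^ 2) = fun α => Real.exp (-(2 * β)) *
        (f (Real.cos α) * (Real.sin α ^ 2 * Real.exp (2 * β * Real.cos α))) := by
    funext α; ring
  have hd : (fun α => Real.exp (-(2 * β)) * Real.exp (2 * β * Real.cos α) * Real.sin α ^ 2) =
      fun α => Real.exp (-(2 * β)) * (Real.sin α ^ 2 * Real.exp (2 * β * Real.cos α)) := by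
    funext α; ring
  rw [hn, hd, intervalIntegral.integral_const_mul, intervalIntegral.integral_const_mul]
  have h1 : (2 / π : ℝ) ≠ 0 := by positivity
  have h2 : Real.exp (-(2 * β)) ≠ 0 := (Real.exp_pos _).ne'
  rw [mul_div_mul_left _ _ h1, mul_div_mul_left _ _ h2]

/-- **The SU(2) one-plaquette Haar expectation of `½ tr U` is `I₂(2β)/I₁(2β)`** — the infinite-volume
/ open-lattice 2-d SU(2) plaquette of the cell's reference table (`⟨cos α⟩_b = I₂(b)/I₁(b)`,
`b = 2β`); GEN-5's kernel enclosures at `b = 1.8, 2.2, 2.7` (`Scoring/OnePlaquetteEnclosures.lean`)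
enclose this Haar expectation at `β = 0.9, 1.1, 1.35`. -/
theorem haar_su2_mean_su2a0_eq_besselI_div (β : ℝ) :
    (∫ U, su2a0 U * Real.exp (-(β * (2 - 2 * su2a0 U))) ∂(haarProbability (Matrix.specialUnitaryGroup (Fin 2) ℂ))) /
        (∫ U, Real.exp (-(β * (2 - 2 * su2a0 U))) ∂(haarProbability (Matrix.specialUnitaryGroup (Fin 2) ℂ))) =
      besselI 2 (2 * β) / besselI 1 (2 * β) := by
  rw [haar_su2_expect_eq_onePlaquetteExpectSU2 β (fun t => t) continuous_id]
  exact onePlaquetteExpectSU2_cos_eq_besselI_div (2 * β)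

end Summit.Ventures.LatticeQCDFlow.Scoring
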